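import Summits.CriticalPhenomena.SAWScalingLimit.Theorems.SAWLeftRightFKGFKGToTraversalBoundSlitNecklaceTame
import Summits.CriticalPhenomena.SAWScalingLimit.Theorems.SAWLeftRightFKGFKGToTraversalBoundEventualShellReduction
import Summits.CriticalPhenomena.SAWScalingLimit.Theorems.SAWLeftRightFKGFKGToTraversalBoundGermTightBdry
import Summits.CriticalPhenomena.SAWScalingLimit.Theorems.FKGToTraversalBound.Negative.R1Split
import Summits.CriticalPhenomena.SAWScalingLimit.Theses.SAWTotalPositivity
import HarnessLib

/-!
# Crux `FKGToTraversalBound` (stmt-CriticalPhenomena-1878) — the SHARPER route-level split (wild residue only)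

Route `route-CriticalPhenomena-SAWLeftRightFKG`, crux decl
`Summit.CriticalPhenomena.SAWScalingLimit.Theses.SAWLeftRightFKG.FKGToTraversalBound` (`LeftRightFKG → SAWTraversalBound`),
line `slit-necklace`, lead c6.  Companion of the landed strategist glue
`Theorems/SAWLeftRightFKGFKGToTraversalBoundSplit.lean` (`Split.FKGToTraversalBound_of_subs`: bubble → engine → germ →
necklace reduction → crux).

Since that glue was written, the TAME case of its fourth child (the static necklace reduction
`UniformSubshellTight → ∀ D a b, IsEndpointApprox D a b → GermTight a → GermTight b → EventualShellTight D a b`) has become a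
THEOREM: `SlitNecklace.necklaceReduction_tame` (p160250, over the planar far-tip witness p154966 and the boundary budget
p159748).  Hence the fourth child can be replaced by its open part alone — the WILD-DOMAIN RESIDUE, verbatim the registered
stub `stub_wildDomains` of the line (`UniformSubshellTight → ∀ D a b, IsEndpointApprox D a b → ¬ EventuallyTame D → GermTight a
→ GermTight b → EventualShellTight D a b`).  This file records the two registered glue statements:

* `necklaceReduction_of_wildResidue` — wild residue ⇒ the strategist's child `NecklaceReduction` (case split on
  `EventuallyTame D`, tame case by `necklaceReduction_tame`);
* `FKGToTraversalBound_of_subsWild` — bubble (stmt-7117 verbatim) → engine (`stub_engine`) → germ tightness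
  (`stub_germTight`) → wild residue (`stub_wildDomains`) → the crux, i.e. the k = 4 split whose fourth child is the wild
  residue; a `--glue-by` target for `ledger route edit … --split FKGToTraversalBound` with that child list.

No `sorry`, no definition, no named literature fact; axioms are the standard three.
-/

noncomputable section

open MeasureTheory Filter Topology Set Metric
open scoped NNReal ENNReal
open Literature.Probability.LatticeModels
open Literature.Probability.RandomPlanarGeometry
open Literature.Probability.RandomPlanarGeometry.SAW
open Summit.CriticalPhenomena.SAWScalingLimit.Theses.SAWLeftRightFKG
open Summit.CriticalPhenomena.SAWScalingLimit.Theses.SAWTotalPositivity (CriticalBubbleBound)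
open Summit.CriticalPhenomena.SAWScalingLimit.Theorems.FKGToTraversalBound.Negative (dom H1At BdryApprox)
open Summit.CriticalPhenomena.SAWScalingLimit.Theorems.FKGToTraversalBound.SlitNecklace

namespace Summit.CriticalPhenomena.SAWScalingLimit.Theorems.FKGToTraversalBound.Split

/-- **Registered glue `necklaceReduction_of_wildResidue`.**  The strategist's fourth child `NecklaceReduction`
(`UniformSubshellTight → ∀ D a b, IsEndpointApprox D a b → GermTight a → GermTight b → EventualShellTight D a b`) follows from
its WILD residue alone: on an eventually tame Dobrushin domain it is the landed `necklaceReduction_tame` (p160250), elsewhere it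
is the residue hypothesis (`stub_wildDomains` verbatim). [folklore] -/
theorem necklaceReduction_of_wildResidue :
    (UniformSubshellTight →
      ∀ (D : DobrushinDomain) (a b : ℝ → Site 2), IsEndpointApprox D a b → ¬ EventuallyTame D →
        GermTight D a b a → GermTight D a b b → EventualShellTight D a b) →
    (UniformSubshellTight →
      ∀ (D : DobrushinDomain) (a b : ℝ → Site 2), IsEndpointApprox D a b →
        GermTight D a b a → GermTight D a b b → EventualShellTight D a b) := by
  intro hW hE D a b hab hGa hGb
  by_cases hD : EventuallyTame D
  · exact necklaceReduction_tame hE D a b hab hD hGa hGb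
  · exact hW hE D a b hab hD hGa hGb

/-- **Registered glue `FKGToTraversalBound_of_subsWild`** — the sharper k = 4 split of the crux: the critical bubble
(stmt-CriticalPhenomena-7117 verbatim), the engine (`LeftRightFKG → CriticalBubbleBound → UniformSubshellTight`, registered
`stub_engine`), germ tightness at both marked points (registered `stub_germTight`) and the wild-domain residue of the necklace
reduction (registered `stub_wildDomains`) imply `FKGToTraversalBound`.  Proof: PA and the bubble feed the engine; the wild residue
upgrades to the full necklace reduction (`necklaceReduction_of_wildResidue`); with the two germs it gives per-shell eventual
tightness, and the landed `stub_eventualShellReduction` (p127535) turns that into (H1) for the approximation at hand. [folklore] -/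
theorem FKGToTraversalBound_of_subsWild :
    CriticalBubbleBound →
    (LeftRightFKG → CriticalBubbleBound → UniformSubshellTight) →
    (∀ (D : DobrushinDomain) (a b : ℝ → Site 2), IsEndpointApprox D a b → GermTight D a b a ∧ GermTight D a b b) →
    (UniformSubshellTight →
      ∀ (D : DobrushinDomain) (a b : ℝ → Site 2), IsEndpointApprox D a b → ¬ EventuallyTame D →
        GermTight D a b a → GermTight D a b b → EventualShellTight D a b) →
    FKGToTraversalBound :=
  fun hB hE hG hW hPA D a b hab =>
    stub_eventualShellReduction D a b hab
      (necklaceReduction_of_wildResidue hW (hE hPA hB) D a b hab (hG D a b hab).1 (hG D a b hab).2)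

/-- The same glue fed through the strategist's inline `FKGToTraversalBound_of_subs` shape: the four NAMED hypotheses of
`FKGToTraversalBound_of_subsWild` are definitionally the inline children `CriticalBubbleBound`, `BubbleFKGEngine`,
`GermTightness` and the wild residue (kernel-checked by this `example`, which restates child 4 in the def-free vocabulary of
`children.json`). -/
example
    (hB : ∃ C : ENNReal, C ≠ ⊤ ∧ ∀ (Ω : Set ℂ) (δ : ℝ) (u v : Site 2), Bornology.IsBounded Ω → 0 < δ →
      (zdGraph 2).Adj u v → weight Ω δ u v Set.univ ≤ C)
    (hE : LeftRightFKG → CriticalBubbleBound → UniformSubshellTight)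
    (hG : ∀ (D : DobrushinDomain) (a b : ℝ → Site 2), IsEndpointApprox D a b → GermTight D a b a ∧ GermTight D a b b)
    (hW : UniformSubshellTight →
      ∀ (D : DobrushinDomain) (a b : ℝ → Site 2), IsEndpointApprox D a b →
        ¬ (∃ N₀ : ℕ, ∀ᶠ δ in 𝓝[>] (0 : ℝ), ∃ (c : Site 2) (C : (zdGraph 2).Walk c c) (S : Finset (Site 2)),
            S.card ≤ N₀ ∧ ∀ x y : Site 2, (discreteDomainGraph (dom C δ) δ).Adj x y ↔
              ((discreteDomainGraph D.carrier δ).Adj x y ∧ x ∉ S ∧ y ∉ S)) →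
        GermTight D a b a → GermTight D a b b → EventualShellTight D a b) :
    FKGToTraversalBound :=
  FKGToTraversalBound_of_subsWild hB hE hG hW

/-- On the R1 class (`Negative.BdryApprox`) and an eventually TAME domain, (H1) for the approximation needs only the bubble
and the engine: the germ child is `germTight_of_bdryApprox` (p128312) and the necklace child is `necklaceReduction_tame`
(p160250).  [folklore] -/
theorem h1At_of_bdryApprox_of_eventuallyTame (hB : CriticalBubbleBound)
    (hE : LeftRightFKG → CriticalBubbleBound → UniformSubshellTight) (hPA : LeftRightFKG)
    (D : DobrushinDomain) (a b : ℝ → Site 2) (hab : IsEndpointApprox D a b) (hbd : BdryApprox D a b)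
    (hD : EventuallyTame D) : H1At D a b :=
  stub_eventualShellReduction D a b hab
    (necklaceReduction_tame (hE hPA hB) D a b hab hD (germTight_of_bdryApprox D a b hab hbd).1
      (germTight_of_bdryApprox D a b hab hbd).2)

end Summit.CriticalPhenomena.SAWScalingLimit.Theorems.FKGToTraversalBound.Split

end
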